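import Summits.Ventures.CertifiedManyBodySolver.Observables.StiffnessTLOddMomentOrbitRowTT
import Summits.Ventures.CertifiedManyBodySolver.Observables.StiffnessTLKineticCeiling
import Summits.Ventures.CertifiedManyBodySolver.Observables.KineticWordD4
import HarnessLib

/-!
# Ventures/CertifiedManyBodySolver — Observables/StiffnessTLSeqCeiling.lean

HONEST FRAMING: one-sided certified CEILINGS on the uniform flux stiffness (helicity modulus / superfluid
weight, Drude-type flux curvature); not a superconductivity verdict; no stiffness floor follows from
equal-time data and an energy window (hubbard-obs-p2 STIFFNESS-SDP.md §4, `Observables/StiffnessNoFloor.lean`).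

Cell `hubbard-obs` (D-0042), seat p2 (stiffness), `prover-hubbard-obs-p2-g9-0`. **SEQUENCE-ROBUST thermodynamic-limit
tower adapters.** Every stiffness ceiling of the cell so far (`fluxStiffness_le_of_torusLimit_kineticDensity_ge`,
`fluxStiffness_le_of_torusLimitTT'_functional_row`, `…_oddMoment_orbit_certificate`, `…_orbitLowerRow_neg`, the leaves
`M3ObsStiffnessCeilingAt[_tp0]`) asks for the flux inequality `ρ_s θ² ≤ E_L(θ) − E_L(0)` (`|θ| ≤ θ₀`) at ALL even
sides `L ≥ L₀`. If shell effects make the small-`θ` curvature of the `(N_L, S^z = 0)` sector ground energy change sign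
along some residue class of sides (it is `< 0` on the open-shell `4×4`, `(7,7)` cluster at `t′ = 0`, kit j243830), no such
uniform `ρ_s > 0` exists and those statements hold VACUOUSLY (HOME/hubbard-obs-p2/STIFFNESS-LINE.md §1 caveat). The
certified ROWS of the programme, however, are typed for EVERY sequence of sides `L_j → ∞`
(`SquareTTPrimeCorrOrbitLowerRow`, Rows/DopedTLCorr.lean), so the same certificates give the ceiling along ANY sequence
of sides on which a uniform flux stiffness exists (e.g. the closed-shell sides only) — this file proves that form:

* `fluxStiffness_le_of_torusLimitTT'_functional_row_seq` — the generic adapter "finite ceiling EVENTUALLY along a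
  prescribed sequence `Ls → ∞` + identification + certificate on the torus-limit class ⇒ `ρ_s ≤ q`" (`t–t'` torus,
  `−1 ≤ δ ≤ 1`; unit sector ground states exist at every side, weak-⋆ compactness along a subsequence of `Ls`);
* `fluxStiffness_le_of_torusLimitTT'_oddMoment_orbit_certificate_seq`, `fluxStiffness_le_of_oddMomentTT_orbitLowerRow_neg_seq`
  — the odd-moment / Krylov-3 (`λ`; at `λ = 0` the `t–t'` kinetic f-sum) `D₄`-orbit row `SquareTTPrimeCorrOrbitLowerRow t' U (1−δ)
  u r S Λ₇ (−X_λ)` plus the energy cap `e₀ ≤ u` give `ρ_s ≤ −r` for every flux stiffness that is uniform ALONG `Ls`;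
* `four_mul_fluxStiffness_le_neg_kineticDensity_of_isTorusLimitOf_seq`, `fluxStiffness_le_of_torusLimit_kineticDensity_ge_seq`
  (`t' = 0`, pure Hubbard torus; registry spelling `…_TT'zero_seq`) — the kinetic (f-sum, T6) tower and row adapter along `Ls`:
  a certified kinetic floor `K ≤ k(ω)` on the torus-limit class gives `ρ_s ≤ −K/4`;
* `squareTTPrimeCorrOrbitLowerRow_kinWord_negKinetic_le` — the `(U, n)`-GENERIC reading of an orbit LOWER row on the kinetic
  word `kinWord` as a kinetic ceiling `−k(ω) ≤ −q` (the M3′ instance is `m3CorrOrbitLowerRow_kinWord_negKinetic_le`,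
  Observables/KineticWordD4.lean), and `fluxStiffness_le_of_kinWord_orbitLowerRow_seq` (`t' = 0`): such a row at cap `u`
  plus `e₀(U, n, 0) ≤ u` gives `ρ_s ≤ −q/4` along `Ls`.

The all-even-`L` statements of the tree are the special case `Ls j = 2(L₀ + j + 1)` (done in
`Observables/RungLeavesStiffnessAnchor.lean`). No definition, no named fact, zero computation, no `sorry`; every bound
is CONDITIONAL on the row / cap hypotheses it names.

References: [Kohn1964]; D. J. Scalapino, S. R. White, S.-C. Zhang, PRB 47 (1993) 7995, §II [ScalapinoWhiteZhang1993];
E. Lipparini, Modern Many-Particle Physics (2008), eq. (8.30) [Lipparini2008]; O. Bratteli, D. W. Robinson I (1987),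
Thm 2.3.15, §4.3.1 [BratteliRobinsonI1987].
-/

noncomputable section

namespace Summit.Ventures.CertifiedManyBodySolver.Observables

open Matrix Finset Filter Topology
open Literature.MathematicalPhysics.QuantumLattice
open Literature.MathematicalPhysics.QuantumLattice.ThermodynamicLimit
open Literature.MathematicalPhysics.QuantumFieldTheory
open Literature.Probability.LatticeModels
open scoped ComplexOrder ComplexConjugate Topology BigOperators

/-! ### §1 The generic adapter along a prescribed sequence of sides (`t–t'` torus) -/

/-- **Generic row adapter along a prescribed sequence, `t–t'` torus.** Let `−1 ≤ δ ≤ 1`, let `Ls → ∞` be a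
sequence of sides and let `Φ L ψ ∈ ℝ` be a per-side functional of unit sector ground states with (i) EVENTUALLY
along `Ls`, `ρ_s ≤ Φ (Ls j) ψ` for every unit `(rectN (1−δ) (Ls j), 0)`-sector ground state `ψ` of
`hubbardTorusTT' (Ls j) 1 t' U`; (ii) along every torus-limit sequence of such ground states (sides `Ms → ∞`),
`Φ (Ms j) (ψ (Ms j)) → Φ∞ ω`; (iii) `Φ∞ ω ≤ q` for every torus limit `ω` (the certificate). Then `ρ_s ≤ q`: unit
sector ground states exist at every side (`exists_unit_isGroundStateInSector_hubbardTorusTT'`), a subsequence of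
`Ls` has a torus limit (weak-⋆ compactness, `InfVolFermionState.exists_isTorusLimitOf_subseq`), and (i)–(iii) apply
there. The all-sides version is `fluxStiffness_le_of_torusLimitTT'_functional_row`. [cite: BratteliRobinsonI1987, §4.3.1] -/
theorem fluxStiffness_le_of_torusLimitTT'_functional_row_seq (tp : ℝ) {U δ ρs q : ℝ} (hδ : -1 ≤ δ)
    (hδ1 : δ ≤ 1) {Ls : ℕ → ℕ} (hLs : Tendsto Ls atTop atTop)
    (Φ : ∀ L : ℕ, Fock (Orb (FermionTorus 2 L)) → ℝ) (Φinf : InfVolFermionState 2 → ℝ)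
    (hfin : ∀ᶠ j in atTop, ∀ ψ : Fock (Orb (FermionTorus 2 (Ls j))),
      IsGroundStateInSector (hubbardTorusTT' (Ls j) 1 tp U) (rectN (1 - δ) (Ls j)) 0 ψ →
        star ψ ⬝ᵥ ψ = 1 → ρs ≤ Φ (Ls j) ψ)
    (hconv : ∀ (ω : InfVolFermionState 2) (Ms : ℕ → ℕ) (ψ : ∀ L, Fock (Orb (FermionTorus 2 L))),
      Tendsto Ms atTop atTop →
      (∀ j, IsGroundStateInSector (hubbardTorusTT' (Ms j) 1 tp U) (rectN (1 - δ) (Ms j)) 0 (ψ (Ms j))) →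
      (∀ j, star (ψ (Ms j)) ⬝ᵥ ψ (Ms j) = 1) → ω.IsTorusLimitOf ψ Ms →
        Tendsto (fun j => Φ (Ms j) (ψ (Ms j))) atTop (𝓝 (Φinf ω)))
    (hrow : ∀ (ω : InfVolFermionState 2) (Ms : ℕ → ℕ) (ψ : ∀ L, Fock (Orb (FermionTorus 2 L))),
      Tendsto Ms atTop atTop →
      (∀ j, IsGroundStateInSector (hubbardTorusTT' (Ms j) 1 tp U) (rectN (1 - δ) (Ms j)) 0 (ψ (Ms j))) →
      (∀ j, star (ψ (Ms j)) ⬝ᵥ ψ (Ms j) = 1) → ω.IsTorusLimitOf ψ Ms → Φinf ω ≤ q) :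
    ρs ≤ q := by
  have hn0 : 0 ≤ 1 - δ := by linarith
  have hn2 : 1 - δ ≤ 2 := by linarith
  -- a unit sector ground state at every side
  let ψ : ∀ L, Fock (Orb (FermionTorus 2 L)) := fun L =>
    Classical.choose (exists_unit_isGroundStateInSector_hubbardTorusTT' L 1 tp U hn0 hn2)
  have hψgs : ∀ L, IsGroundStateInSector (hubbardTorusTT' L 1 tp U) (rectN (1 - δ) L) 0 (ψ L) := fun L =>
    (Classical.choose_spec (exists_unit_isGroundStateInSector_hubbardTorusTT' L 1 tp U hn0 hn2)).1
  have hψ1 : ∀ L, star (ψ L) ⬝ᵥ ψ L = 1 := fun L =>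
    (Classical.choose_spec (exists_unit_isGroundStateInSector_hubbardTorusTT' L 1 tp U hn0 hn2)).2
  -- a torus-limit point along a subsequence of the prescribed sides (weak-⋆ compactness)
  obtain ⟨φ, hφ, ω, hω⟩ :=
    InfVolFermionState.exists_isTorusLimitOf_subseq ψ hLs (fun j => hψ1 (Ls j))
  have hLs' : Tendsto (Ls ∘ φ) atTop atTop := hLs.comp hφ.tendsto_atTop
  have hev : ∀ᶠ j in atTop, ρs ≤ Φ ((Ls ∘ φ) j) (ψ ((Ls ∘ φ) j)) := by
    filter_upwards [hφ.tendsto_atTop.eventually hfin] with j hj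
    exact hj (ψ _) (hψgs _) (hψ1 _)
  have hlim := hconv ω (Ls ∘ φ) ψ hLs' (fun j => hψgs _) (fun j => hψ1 _) hω
  have hle : ρs ≤ Φinf ω := ge_of_tendsto hlim hev
  exact hle.trans (hrow ω (Ls ∘ φ) ψ hLs' (fun j => hψgs _) (fun j => hψ1 _) hω)

/-! ### §2 The odd-moment (Krylov-3; at `λ = 0` the `t–t'` kinetic f-sum) ceiling along a prescribed sequence -/

/-- **The `t–t'` odd-moment `D₄`-orbit certificate along a prescribed sequence.** Let `−1 ≤ δ ≤ 1`, `λ ∈ ℝ`,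
`S ⊆ D₄` nonempty, `Ls → ∞`, and let `ρ_s` (with scale `θ₀ > 0`) satisfy the flux inequality
`ρ_s θ² ≤ E_{Ls j}(θ) − E_{Ls j}(0)` (`|θ| ≤ θ₀`, `E_L = fluxEnergyTT' L t' U δ`) at EVERY side of the sequence. If
`|S|⁻¹ Σ_{γ∈S} Re ω_{γΛ₇}(Γ(d4Emb γ 0 Λ₇) X_λ) ≤ q` for every torus limit `ω` of unit sector ground states (any sides
`Ms → ∞`), then `ρ_s ≤ q`. The all-even-sides version is `fluxStiffness_le_of_torusLimitTT'_oddMoment_orbit_certificate`.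
[cite: Lipparini2008, eq. (8.30)] -/
theorem fluxStiffness_le_of_torusLimitTT'_oddMoment_orbit_certificate_seq (tp : ℝ) {U δ ρs θ₀ q : ℝ}
    (lam : ℝ) (S : Finset (DihedralGroup 4)) (hS : S.Nonempty) (hδ : -1 ≤ δ) (hδ1 : δ ≤ 1) (hθ₀ : 0 < θ₀)
    {Ls : ℕ → ℕ} (hLs : Tendsto Ls atTop atTop)
    (hst : ∀ (j : ℕ) [NeZero (Ls j)] (θ : ℝ), |θ| ≤ θ₀ →
      ρs * θ ^ 2 ≤ fluxEnergyTT' (Ls j) tp U δ θ - fluxEnergyTT' (Ls j) tp U δ 0)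
    (hrow : ∀ (ω : InfVolFermionState 2) (Ms : ℕ → ℕ) (ψ : ∀ L, Fock (Orb (FermionTorus 2 L))),
      Tendsto Ms atTop atTop →
      (∀ j, IsGroundStateInSector (hubbardTorusTT' (Ms j) 1 tp U) (rectN (1 - δ) (Ms j)) 0 (ψ (Ms j))) →
      (∀ j, star (ψ (Ms j)) ⬝ᵥ ψ (Ms j) = 1) → ω.IsTorusLimitOf ψ Ms →
        (S.card : ℝ)⁻¹ * ∑ γ ∈ S, rotOddMomentLimitFunctionalTT tp U lam γ ω ≤ q) :
    ρs ≤ q := by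
  have hcard : (0 : ℝ) < (S.card : ℝ) := Nat.cast_pos.2 (Finset.card_pos.2 hS)
  refine fluxStiffness_le_of_torusLimitTT'_functional_row_seq tp hδ hδ1 hLs
    (fun L ψ => (S.card : ℝ)⁻¹ * ∑ γ ∈ S, rotOddMomentFunctionalTT' tp U δ lam γ L ψ)
    (fun ω => (S.card : ℝ)⁻¹ * ∑ γ ∈ S, rotOddMomentLimitFunctionalTT tp U lam γ ω) ?_ ?_ hrow
  · filter_upwards [hLs.eventually_ge_atTop 3] with j hj ψ hgs h1
    haveI : NeZero (Ls j) := ⟨by omega⟩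
    have hsum : ∑ _γ ∈ S, ρs ≤ ∑ γ ∈ S, rotOddMomentFunctionalTT' tp U δ lam γ (Ls j) ψ :=
      Finset.sum_le_sum fun γ _ =>
        fluxStiffness_le_rotOddMomentFunctionalTT' (Ls j) hj tp hθ₀ (hst j) hgs h1 lam γ
    rw [Finset.sum_const, nsmul_eq_mul] at hsum
    rw [inv_mul_eq_div, le_div_iff₀ hcard]
    linarith
  · intro ω Ms ψ hMs hgs h1 hω
    refine Tendsto.const_mul _ (tendsto_finsetSum _ fun γ _ => ?_)
    have hlim : Tendsto (fun j => (torusAvgExpect (Ms j) (d4ShiftSet γ 0 (box 2 7))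
        (fermionEmbed (PolySite.d4Emb γ 0 (box 2 7)) (oddMomentObsTT tp U lam)) (ψ (Ms j))).re) atTop
        (𝓝 (rotOddMomentLimitFunctionalTT tp U lam γ ω)) :=
      (Complex.continuous_re.tendsto _).comp (hω _ _)
    refine hlim.congr' ?_
    filter_upwards [hMs.eventually_ge_atTop 15] with j hj
    haveI : NeZero (Ms j) := ⟨by omega⟩
    exact (rotOddMomentFunctionalTT'_eq_torusAvgExpect (Ms j) tp U δ lam γ hj (hgs j)).symm

/-- **Registry shape along a prescribed sequence: a LOWER orbit row on the NEGATED word is a stiffness CEILING.**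
The cell `SquareTTPrimeCorrOrbitLowerRow t' U (1−δ) u r S Λ₇ (−X_λ)` (`S` nonempty) with the certified energy cap
`e₀(U, 1−δ, t') ≤ u` gives `ρ_s ≤ −r` for every `ρ_s` (scale `θ₀ > 0`) satisfying the flux inequality at every side of
a sequence `Ls → ∞`. At `λ = 0`, `X_0 = ½ k₀^{tt′}` and this is the `t–t'` kinetic f-sum ceiling (the shape of the A0 `kinx`
node `cert_obs2_kinx_…`). [cite: ScalapinoWhiteZhang1993, §II] -/
theorem fluxStiffness_le_of_oddMomentTT_orbitLowerRow_neg_seq (tp : ℝ) {U δ ρs θ₀ : ℝ} (lam : ℝ) {u r : ℚ}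
    (S : Finset (DihedralGroup 4)) (hS : S.Nonempty) (hδ : -1 ≤ δ) (hδ1 : δ ≤ 1) (hθ₀ : 0 < θ₀)
    {Ls : ℕ → ℕ} (hLs : Tendsto Ls atTop atTop)
    (hst : ∀ (j : ℕ) [NeZero (Ls j)] (θ : ℝ), |θ| ≤ θ₀ →
      ρs * θ ^ 2 ≤ fluxEnergyTT' (Ls j) tp U δ θ - fluxEnergyTT' (Ls j) tp U δ 0)
    (hrow : SquareTTPrimeCorrOrbitLowerRow tp U (1 - δ) u r S (box 2 7) (-oddMomentObsTT tp U lam))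
    (hu : energyDensityTT' 1 tp U (1 - δ) ≤ ((u : ℚ) : ℝ)) :
    ρs ≤ -((r : ℚ) : ℝ) := by
  refine fluxStiffness_le_of_torusLimitTT'_oddMoment_orbit_certificate_seq tp lam S hS hδ hδ1 hθ₀ hLs hst
    fun ω Ms ψ hMs hgs h1 hω => ?_
  have h := hrow ω Ms ψ hMs hgs h1 hω hu
  have hneg : ∀ γ : DihedralGroup 4,
      (ω.expect (d4ShiftSet γ 0 (box 2 7))
        (fermionEmbed (PolySite.d4Emb γ 0 (box 2 7)) (-oddMomentObsTT tp U lam))).re =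
        -rotOddMomentLimitFunctionalTT tp U lam γ ω := fun γ => by
    rw [rotOddMomentLimitFunctionalTT, map_neg, map_neg, Complex.neg_re]
  simp only [hneg, Finset.sum_neg_distrib, mul_neg] at h
  linarith

/-! ### §3 The kinetic (f-sum, T6) ceiling along a prescribed sequence (`t' = 0`) -/

/-- **The kinetic tower lemma along a prescribed sequence** (pure Hubbard torus `hubbardTorus 2 L 1 U`). If
`ω` is a torus limit of unit `(rectN (1−δ) (Ls j), 0)`-sector ground states `ψ (Ls j)` along sides `Ls → ∞`, and
`ρ_s > 0` (scale `θ₀ > 0`) satisfies `ρ_s θ² ≤ E_{Ls j}(θ) − E_{Ls j}(0)` (`E_L = fluxEnergy L U δ`, `|θ| ≤ θ₀`) at every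
side OF THE SEQUENCE, then `4ρ_s ≤ −k(ω)` with `k(ω)` the kinetic energy density in bond form. (The all-even-sides
version `four_mul_fluxStiffness_le_neg_kineticDensity_of_isTorusLimitOf` asks the flux inequality at every even
`L ≥ L₀`; only the sides of the sequence are ever used.) [cite: ScalapinoWhiteZhang1993, §II] -/
theorem four_mul_fluxStiffness_le_neg_kineticDensity_of_isTorusLimitOf_seq
    {ω : InfVolFermionState 2} {ψ : ∀ L, Fock (Orb (FermionTorus 2 L))} {Ls : ℕ → ℕ}
    (hω : ω.IsTorusLimitOf ψ Ls) (hLs : Tendsto Ls atTop atTop)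
    {U δ ρs θ₀ : ℝ} (hρs : 0 < ρs) (hθ₀ : 0 < θ₀)
    (hst : ∀ (j : ℕ) [NeZero (Ls j)] (θ : ℝ), |θ| ≤ θ₀ →
      ρs * θ ^ 2 ≤ fluxEnergy (Ls j) U δ θ - fluxEnergy (Ls j) U δ 0)
    (hψ : ∀ j, IsGroundStateInSector (hubbardTorus 2 (Ls j) 1 U) (rectN (1 - δ) (Ls j)) 0 (ψ (Ls j)))
    (h1 : ∀ j, star (ψ (Ls j)) ⬝ᵥ ψ (Ls j) = 1) :
    4 * ρs ≤ -(∑ i : Fin 2, -(1 : ℝ) * ∑ σ : Fin 2,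
        ((ω.expect {0, 0 + unitVec i}
            ((cAt 0 (mem_insert_self _ _) σ)ᴴ *
              cAt (0 + unitVec i) (mem_insert_of_mem (mem_singleton_self _)) σ)).re +
          (ω.expect {0, 0 + unitVec i}
            ((cAt (0 + unitVec i) (mem_insert_of_mem (mem_singleton_self _)) σ)ᴴ *
              cAt 0 (mem_insert_self _ _) σ)).re)) := by
  -- eventually along the sequence: `4 ρ_s ≤ -Re(averaged expectation of the hopping mean energy)`
  have hev : ∀ᶠ j in atTop, 4 * ρs ≤
      -(torusAvgExpect (Ls j) (thicken ({0} : Finset (Site 2)) 1)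
        ((hubbardFermionInteraction 2 1 0).meanEnergyObs 1) (ψ (Ls j))).re := by
    filter_upwards [hLs.eventually_ge_atTop 3] with j hL3
    haveI : NeZero (Ls j) := ⟨by omega⟩
    have hfin := four_mul_stiffness_mul_sq_le_neg_re_expect_hubbardTorus_zero hL3 hρs hθ₀
      (hst j) (hψ j) (h1 j)
    rw [torusAvgExpect_hubbard_meanEnergyObs 1 0 hL3, ← Complex.ofReal_natCast, ← Complex.ofReal_pow,
      Complex.div_ofReal_re]
    have hLpos : (0 : ℝ) < ((Ls j : ℕ) : ℝ) ^ 2 := by positivity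
    rw [← neg_div, le_div_iff₀ hLpos]
    have h4 : 4 * ρs * ((Ls j : ℕ) : ℝ) ^ 2 = 4 * (ρs * ((Ls j : ℕ) : ℝ) ^ 2) := by ring
    rw [h4]
    exact hfin
  have hlim : Tendsto (fun j => -(torusAvgExpect (Ls j) (thicken ({0} : Finset (Site 2)) 1)
        ((hubbardFermionInteraction 2 1 0).meanEnergyObs 1) (ψ (Ls j))).re) atTop
      (𝓝 (-(ω.expect (thicken ({0} : Finset (Site 2)) 1)
        ((hubbardFermionInteraction 2 1 0).meanEnergyObs 1)).re)) :=
    ((Complex.continuous_re.tendsto _).comp (hω _ _)).neg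
  have h := ge_of_tendsto hlim hev
  have hsplit := hω.isTranslationInvariant.hubbardEnergyDensity_eq_docc_add_hopping 1 0
  rw [zero_mul, zero_add] at hsplit
  change 4 * ρs ≤ -ω.hubbardEnergyDensity 1 0 at h
  rw [← hsplit]
  exact h

/-- **Row adapter along a prescribed sequence (`t' = 0`): a certified thermodynamic-limit kinetic FLOOR is a
certified stiffness CEILING for every flux stiffness uniform along `Ls`.** If `K ≤ k(ω)` for every torus limit `ω`
of unit `(rectN (1−δ) L, 0)`-sector ground states of `hubbardTorus 2 L 1 U` (any sides `Ms → ∞`), then every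
`ρ_s > 0` (scale `θ₀ > 0`) with the flux inequality at every side of `Ls → ∞` satisfies `ρ_s ≤ −K/4` (tree units;
Hazra–Verma–Randeria `D_s = ρ_s/2 ≤ −K/8`; Scalapino–White–Zhang `D/(πe²) = 2ρ_s ≤ −K/2`). [cite: ScalapinoWhiteZhang1993, §II] -/
theorem fluxStiffness_le_of_torusLimit_kineticDensity_ge_seq {U δ ρs θ₀ K : ℝ} (hδ : -1 ≤ δ)
    (hρs : 0 < ρs) (hθ₀ : 0 < θ₀) {Ls : ℕ → ℕ} (hLs : Tendsto Ls atTop atTop)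
    (hst : ∀ (j : ℕ) [NeZero (Ls j)] (θ : ℝ), |θ| ≤ θ₀ →
      ρs * θ ^ 2 ≤ fluxEnergy (Ls j) U δ θ - fluxEnergy (Ls j) U δ 0)
    (hrow : ∀ (ω : InfVolFermionState 2) (Ms : ℕ → ℕ) (ψ : ∀ L, Fock (Orb (FermionTorus 2 L))),
      Tendsto Ms atTop atTop →
      (∀ j, IsGroundStateInSector (hubbardTorus 2 (Ms j) 1 U) (rectN (1 - δ) (Ms j)) 0 (ψ (Ms j))) →
      (∀ j, star (ψ (Ms j)) ⬝ᵥ ψ (Ms j) = 1) → ω.IsTorusLimitOf ψ Ms →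
      K ≤ ∑ i : Fin 2, -(1 : ℝ) * ∑ σ : Fin 2,
        ((ω.expect {0, 0 + unitVec i}
            ((cAt 0 (mem_insert_self _ _) σ)ᴴ *
              cAt (0 + unitVec i) (mem_insert_of_mem (mem_singleton_self _)) σ)).re +
          (ω.expect {0, 0 + unitVec i}
            ((cAt (0 + unitVec i) (mem_insert_of_mem (mem_singleton_self _)) σ)ᴴ *
              cAt 0 (mem_insert_self _ _) σ)).re)) :
    ρs ≤ -K / 4 := by
  have hn2 : 1 - δ ≤ 2 := by linarith
  -- a unit sector ground state at every side
  let ψ : ∀ L, Fock (Orb (FermionTorus 2 L)) := fun L =>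
    Classical.choose (InfVolFermionState.exists_unit_isGroundStateInSector_rectN 1 U hn2 L)
  have hψ1 : ∀ L, star (ψ L) ⬝ᵥ ψ L = 1 := fun L =>
    (Classical.choose_spec (InfVolFermionState.exists_unit_isGroundStateInSector_rectN 1 U hn2 L)).1
  have hψgs : ∀ L, IsGroundStateInSector (hubbardTorus 2 L 1 U) (rectN (1 - δ) L) 0 (ψ L) := fun L =>
    (Classical.choose_spec (InfVolFermionState.exists_unit_isGroundStateInSector_rectN 1 U hn2 L)).2
  -- a torus-limit point along a subsequence of the prescribed sides (weak-⋆ compactness)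
  obtain ⟨φ, hφ, ω, hω⟩ :=
    InfVolFermionState.exists_isTorusLimitOf_subseq ψ hLs (fun j => hψ1 (Ls j))
  have hLs' : Tendsto (Ls ∘ φ) atTop atTop := hLs.comp hφ.tendsto_atTop
  have htower := four_mul_fluxStiffness_le_neg_kineticDensity_of_isTorusLimitOf_seq hω hLs' hρs hθ₀
    (fun j => @hst (φ j)) (fun j => hψgs _) (fun j => hψ1 _)
  have hK := hrow ω (Ls ∘ φ) ψ hLs' (fun j => hψgs _) (fun j => hψ1 _) hω
  linarith

/-- **Registry spelling** of `fluxStiffness_le_of_torusLimit_kineticDensity_ge_seq`: the ground-state class written over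
the `t–t'` torus at `t' = 0` (`hubbardTorusTT' L 1 0 U = hubbardTorus 2 L 1 U`, `hubbardTorusTT'_zero`), exactly as the
cell's certified kinetic rows are typed. [cite: ScalapinoWhiteZhang1993, §II] -/
theorem fluxStiffness_le_of_torusLimit_kineticDensity_ge_TT'zero_seq {U δ ρs θ₀ K : ℝ} (hδ : -1 ≤ δ)
    (hρs : 0 < ρs) (hθ₀ : 0 < θ₀) {Ls : ℕ → ℕ} (hLs : Tendsto Ls atTop atTop)
    (hst : ∀ (j : ℕ) [NeZero (Ls j)] (θ : ℝ), |θ| ≤ θ₀ →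
      ρs * θ ^ 2 ≤ fluxEnergy (Ls j) U δ θ - fluxEnergy (Ls j) U δ 0)
    (hrow : ∀ (ω : InfVolFermionState 2) (Ms : ℕ → ℕ) (ψ : ∀ L, Fock (Orb (FermionTorus 2 L))),
      Tendsto Ms atTop atTop →
      (∀ j, IsGroundStateInSector (hubbardTorusTT' (Ms j) 1 0 U) (rectN (1 - δ) (Ms j)) 0 (ψ (Ms j))) →
      (∀ j, star (ψ (Ms j)) ⬝ᵥ ψ (Ms j) = 1) → ω.IsTorusLimitOf ψ Ms →
      K ≤ ∑ i : Fin 2, -(1 : ℝ) * ∑ σ : Fin 2,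
        ((ω.expect {0, 0 + unitVec i}
            ((cAt 0 (mem_insert_self _ _) σ)ᴴ *
              cAt (0 + unitVec i) (mem_insert_of_mem (mem_singleton_self _)) σ)).re +
          (ω.expect {0, 0 + unitVec i}
            ((cAt (0 + unitVec i) (mem_insert_of_mem (mem_singleton_self _)) σ)ᴴ *
              cAt 0 (mem_insert_self _ _) σ)).re)) :
    ρs ≤ -K / 4 := by
  refine fluxStiffness_le_of_torusLimit_kineticDensity_ge_seq hδ hρs hθ₀ hLs hst
    fun ω Ms ψ hMs hψ h1 hω => ?_
  exact hrow ω Ms ψ hMs (fun j => by simpa only [hubbardTorusTT'_zero] using hψ j) h1 hω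

/-! ### §4 The kinetic word: `(U, n)`-generic reading and the stiffness ceiling along a sequence (`t' = 0`) -/

/-- **An orbit LOWER row on the kinetic word is a kinetic FLOOR, i.e. a ceiling on `−k` — generic anchor `(U, n, t')`.**
`SquareTTPrimeCorrOrbitLowerRow t' U n u q univ W k̂` gives, for every torus limit `ω` of unit `(rectN n L, S^z = 0)`-sector
ground states of `hubbardTorusTT' L 1 t' U` with `energyDensityTT' 1 t' U n ≤ u`, `−k(ω) ≤ −q` (bond form; the nearest-neighbour
kinetic energy density). The M3′ instance (`U = 8`, `n = 7/8`) is `m3CorrOrbitLowerRow_kinWord_negKinetic_le`. [cite: ScalapinoWhiteZhang1993, §II] -/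
theorem squareTTPrimeCorrOrbitLowerRow_kinWord_negKinetic_le {tp U n : ℝ} {u q : ℚ}
    (h : SquareTTPrimeCorrOrbitLowerRow tp U n u q Finset.univ kinWindow kinWord) :
    ∀ (ω : InfVolFermionState 2) (Ls : ℕ → ℕ) (ψ : ∀ L, Fock (Orb (FermionTorus 2 L))),
      Tendsto Ls atTop atTop →
      (∀ j, IsGroundStateInSector (hubbardTorusTT' (Ls j) 1 tp U) (rectN n (Ls j)) 0 (ψ (Ls j))) →
      (∀ j, star (ψ (Ls j)) ⬝ᵥ ψ (Ls j) = 1) → ω.IsTorusLimitOf ψ Ls →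
      energyDensityTT' 1 tp U n ≤ ((u : ℚ) : ℝ) →
      -(∑ i : Fin 2, -(1 : ℝ) * ∑ σ : Fin 2,
          ((ω.expect {0, 0 + unitVec i}
              ((cAt 0 (mem_insert_self _ _) σ)ᴴ * cAt (0 + unitVec i) (mem_insert_of_mem (mem_singleton_self _)) σ)).re +
            (ω.expect {0, 0 + unitVec i}
              ((cAt (0 + unitVec i) (mem_insert_of_mem (mem_singleton_self _)) σ)ᴴ * cAt 0 (mem_insert_self _ _) σ)).re)) ≤
        -((q : ℚ) : ℝ) := by
  intro ω Ls ψ h1 h2 h3 h4 hu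
  have hh := h ω Ls ψ h1 h2 h3 h4 hu
  rw [re_orbitMean_kinWord_eq_kineticDensity h4.isTranslationInvariant] at hh
  linarith

/-- **Stiffness CEILING from a certified kinetic-word orbit row along a prescribed sequence (`t' = 0`).** The cell
`SquareTTPrimeCorrOrbitLowerRow 0 U (1−δ) u q univ W k̂` (`−1 ≤ δ`; the shape of the rung-0b `kinlo` node) plus the energy cap
`e₀(U, 1−δ, 0) ≤ u` give `ρ_s ≤ −q/4` for every `ρ_s > 0` (scale `θ₀ > 0`) satisfying the flux inequality at every side of
`Ls → ∞` (tree units). [cite: ScalapinoWhiteZhang1993, §II] -/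
theorem fluxStiffness_le_of_kinWord_orbitLowerRow_seq {U δ ρs θ₀ : ℝ} {u q : ℚ} (hδ : -1 ≤ δ)
    (hρs : 0 < ρs) (hθ₀ : 0 < θ₀) {Ls : ℕ → ℕ} (hLs : Tendsto Ls atTop atTop)
    (hst : ∀ (j : ℕ) [NeZero (Ls j)] (θ : ℝ), |θ| ≤ θ₀ →
      ρs * θ ^ 2 ≤ fluxEnergy (Ls j) U δ θ - fluxEnergy (Ls j) U δ 0)
    (hrow : SquareTTPrimeCorrOrbitLowerRow 0 U (1 - δ) u q Finset.univ kinWindow kinWord)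
    (hu : energyDensityTT' 1 0 U (1 - δ) ≤ ((u : ℚ) : ℝ)) :
    ρs ≤ -((q : ℚ) : ℝ) / 4 := by
  refine fluxStiffness_le_of_torusLimit_kineticDensity_ge_TT'zero_seq hδ hρs hθ₀ hLs hst
    fun ω Ms ψ hMs hψ h1 hω => ?_
  have h := squareTTPrimeCorrOrbitLowerRow_kinWord_negKinetic_le hrow ω Ms ψ hMs hψ h1 hω hu
  linarith

end Summit.Ventures.CertifiedManyBodySolver.Observables

end
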